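import Mathlib
import Literature.MathematicalPhysics.QuantumFieldTheory.Balaban1983to89.B16Cor3Scales

/-!
# `Balaban1983to89.B16Cor3Ops` — [Balaban1989LargeFieldII] pp. 378–380, 387, 390: the OPERATIONS behind leaves
U1 and L1 of the (2.50)/(0.1) bookkeeping — the positivity inequality (1.73) typed as an interface of POSITIVE
OPERATIONS, its iteration over composed operations, and the 𝐑-operation formula (1.72) typed as term data whose
injective indexing (`hinj`), majorisation (`hU1`, `hmaj`), termwise non-negativity (`hL1`) and all-small form (`hform`)
— the hypotheses of the siblings `B16Cor3.uvIneq_of_structure` / `B16Cor3Scales.uvIneq_of_structure_classes` that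
gen 1–3 of this lineage left as leaf U1 / L1 (cell GAPS G-adv3-1) — are PROVED from the printed structure over located
factor leaves; plus the reading-(β) entropy lemma WITHOUT injectivity (fibrewise; the history count as a fibre bound)

CITATION HEADER (lean-in-tree rule 2026-08-18).  Source: T. Bałaban, *Large field renormalization. II. Localization,
exponentiation, and bounds for the 𝐑 operation*, Commun. Math. Phys. **122**, 355–392 (1989), doi:10.1007/bf01238433
(cell paper B16 = [V]; held: `paper:balaban1989-cmp122-large-field-ii`; journal page = PDF page + 354; every quotation
below is read from the page renders `HOME/b2b-balaban-ref1/pages/1989-cmp122-large-field-II/…-p024…p026, p029, p033,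
p036-x2.png`), with [III] = T. Bałaban, *Convergent renormalization expansions for lattice gauge theories*, Commun.
Math. Phys. **119**, 243–285 (1988) [Balaban1988Convergent] (2.18) p. 257, (2.49)–(2.50) p. 264 (quoted in the sibling
`B14Cor3`).  Fourth module of the surge-node lineage `B14Cor3` (gen 1: (2.50) ⇐ five named leaves H, U1, U2, L1, L2) →
`B16Cor3` (gen 2: U2 ⇐ injective indexing `fam` + weights + entropy; L2 ⇐ the printed all-small form) → `B16Cor3Scales`
(gen 3: the entropy hypothesis discharged with a k-uniform constant under both printed bookkeepings) → here (gen 4: the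
remaining per-term hypotheses `hU1`, `hinj`, `hmaj`, `hL1`, `hform`).  No sibling module is modified.

(a) THE PRINTED TEXT.  p. 378 [24]: *"To write its final form, we introduce a new 𝐓-operation. It is defined for a
component of Z by a composition of the integration in (1.70) localized in this component, and the integration together
with the 𝐓_h-operation in (1.100) [IV], also localized in this component. We use the fact that these integrations
factorize in components of Z. We denote the component by X, it may be any component of the first, or of the second
class, and we define 𝐓′_k(X) = (1/(2^d d!)) Σ_{{Ω^c_j∩X, Z_j∩X}, r} ∫dB⌈_X σ(g_kB)δ_{rT}(B)χ′(X) · ∫dV_h⌈ … 𝐓_h(Z_h∩X) ·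
exp[…] (1.71)"*; p. 379 [25]: *"All the expressions in the above integral operation are localized in the domain X. With
the help of these operations we define the 𝐑-operation: (𝐑ρ_k)(V_k) = Σ_{Z_k} Σ_{{Y_1,…,Y_m}} χ_k((Ω_k∩(Y_1^c)^{~2}∩⋯
∩(Y_m^c)^{~2})^{~4}) · (Σ_{{Ω^c_j,Z_j}} 𝐓″_k(Z_k)) exp A′_k(1/(g_k(·))², U_k) · Π_{i=1}^{m} χ^c_k(Y_i^{~−6})χ_{k,Λ_i}χ_i
δ_{G_i}(V′_k)𝐓′_k(Y_i) · {Σ_{n≥0} Σ_{{X_1,…,X_n}} Π_{j=1}^{n} 𝐓′_k(X_j) exp Σ_Y V(Y,U_k)}, (1.72) where Ω_k is the new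
k^{th} domain defined by the determining set of the configuration U_k. Notice that the terms V(Y,U_k) depend on the
sequence {Ω^c_j, Z_j} restricted to the components of Z contained in Y, and that the sum in the definition (1.71) acts
also on the last exponential in (1.72)."*; pp. 379–380 [25–26]: *"All the expressions in the definition (1.71), for the
configuration U, are real, and the exponential density in the integral is positive. This implies the inequalities
|𝐓′_k(X,(𝐔,𝐉))F| = |𝐓′_k(X,(U,0))e^σF| ≤ 𝐓′_k(X,(U,0))|e^σF| ≤ (𝐓′_k(X,(U,0))1) sup e^{|σ|}|F|, (1.73) … where σ
is the small term of the first order in A′, 𝐉, and F is a function of the integration variables in the integral (1.71).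
… From the inequality (1.73) it is clear that we have to find a bound of 𝐓′_k(X,(U,0))1, which we denote for
simplicity by 𝐓′_k(X)1."*; p. 387 [33], after (1.89) *"𝐓′_k(X)1 ≤ exp(−2(1+β₀)⁻¹p₀(g_k)). (1.89)"*: *"Next, we have
noticed already that the inequality (1.79) holds for the 𝐓-operation connected with an arbitrary large field region.
The inequality (1.80) holds quite generally for such regions, hence also an improved bound (1.89), with the additional
term −κ₁d_k(X) in the exponential. This implies the inequality (2.50) [III], hence Corollary 3."*; p. 383 [29]:
*"Finally, the summations over the admissible sequences can be replaced by the factors exp O(1)(MR_j)^{−d}|Z_j|."*;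
p. 390 [36]: *"{⋯} = exp 𝐑′^{(k)} = exp Σ𝐑′^{(k)}(X). (1.98)"*, *"|𝐑′^{(k)}(X,(𝐔,𝐉))| ≤ exp(−p₀(g_k)) exp(−κd_k(X)).
(1.100)"*, *"The new large field region is equal to Z_k ∪ ⋃_{i=1}^{m} Y_i, and the operation 𝐓_k for a component Y of
the set ⋃_{i=1}^{m} Y_i has the form 𝐓_k(Y) = χ^c_k(Y^{~−6})χ_{k,Λ}δ_G(V_kV_Λ⁻¹)𝐓′_k(Y). (1.102)  From (1.72), (1.98),
and the above definitions, it follows that the result 𝐑ρ_k of the 𝐑-operation can be written in the form (2.18)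
[III]"*.  (p. 356 [2]: the operations 𝐓″_k are not displayed in [V] — cell GAPS C-B16-9.)

(b) THE TYPED READING.  §1: an operation `𝐓′_k(X,(U,0))`, `𝐓″_k`, `𝐓_k(Y)` at a REAL configuration is a POSITIVE
OPERATION on real functions of the fields — `PosOp`: a map `T : (C → ℝ) → (C → ℝ)` that is monotone and homogeneous
(the two properties of an integral against a positive density that (1.73) uses; the finite positive functional of the
sibling `B16.ineq173` is the instance `PosOp.ofKernel`, multiplication by a characteristic function is `PosOp.mulOp`,
the parenthesised history sum `(Σ_{{Ω^c_j,Z_j}} 𝐓″_k(Z_k))` is `PosOp.sumOp`, composition is `PosOp.comp`); (1.73) at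
`(U,0)` is `PosOp.abs_apply_le` (`|TF| ≤ sup|F| · T1`), non-negativity is `PosOp.apply_nonneg`, and the ITERATION of
(1.73) over a composite of operations with uniform weights `T_i 1 ≤ w_i` gives `(T_1∘⋯∘T_n)1 ≤ Π w_i` (`PosOp.pi_one_le`)
— the step from the per-component (1.89) to a product of weights.  §2: (1.72) as term data `Repr172` over the run's
configuration space: a summand is indexed by the pair (set of components of the new region `Z_k`, the family
`{Y_1,…,Y_m}`) (field `index_inj`: the summand is determined by `(Z_k, {Y_i})`, a region by its components — every
history sum sits INSIDE the summand, as printed); it is `χ_a · TZ_a[exp A′_k · TYs_a(curly_a)]` with `TZ_a` = the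
parenthesised operation of `Z_k`, `TYs_a` = `Π_i 𝐓_k(Y_i)` ((1.102); one composite operation), `curly_a` = the curly
bracket (= `exp Σ_X 𝐑′^{(k)}(X)` by (1.98), real on real fields); the all-small summand has `Z_k = ∅`, `m = 0`, both
operations the identity.  PROVED: the family map `a ↦ (components of Z_k) ⊎ {Y_i}` into `Fin 2 × 𝐃_k` is INJECTIVE
(`fam_injective` — the `hinj` of gen 2/3, reading (α)); `|term_a| ≤ e^{(E′+ε′)N} Π_{X∈Z_k} w₀(X) Π_i w₁(Y_i)` from (1.73)
twice and the four factor leaves [`TZ_a 1 ≤ Π_{X} w₀(X)` = (1.79)/(1.89)-improved for the new region, per component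
(p. 387 "holds for the 𝐓-operation connected with an arbitrary large field region", p. 378 "these integrations factorize
in components of Z", p. 383 history-count sentence); `TYs_a 1 ≤ Π_i w₁(Y_i)` = (1.89)-improved per `Y_i` composed by
`pi_one_le`; `A′_k ≤ E′N` = the upper (2.49) [III] bookkeeping; `|curly| ≤ e^{ε′N}` = (1.98) with (1.99)/(1.100) summed]
(`abs_term_le` — leaf U1); `term_a ≥ 0` from positivity, `χ ≥ 0` and `curly ≥ 0` (`term_nonneg` — leaf L1, whose only
residual is the reality/non-negativity of the bracket, cell GAPS G-adv3-2a "L1-real"); the all-small form `χ_k ·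
exp[A′_k + Σ𝐑′]` (`form_allSmall`); and the composition `uvIneq_of_repr172` = `B16Cor3Scales.uvIneq_of_structure_classes`
with TWO classes (components of `Z_k` / the `Y_i`) and every per-term hypothesis discharged — what remains are the run
datum `hH` ((1.72) holds for the density), the factor leaves, the lower (2.49) bookkeeping `hA'` and the cube count `hπ`.
§3: reading (β) (one token per (birth scale, region), histories summed GLOBALLY as in (2.18) [III]) has NO injective
family map (two histories can carry the same family of regions); the entropy lemma of gen 2 is re-proved FIBREWISE
(`sum_major_le_exp_fiber`: `Σ_a major_a ≤ B₀e^{E}` from `Σ_{a : fam a = W} major_a ≤ B₀Π_{Y∈W}w(Y)` for every family `W`,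
no injectivity), the fibre bound is reduced to a per-summand majorant times a FIBRE COUNT `#{a : fam a = W} ≤ Π_{Y∈W}
N(Y)` (`fiber_le_of_card` — the p. 383 sentence: `N(Y) = exp O(1)(MR_j)^{−d}|Y|` admissible sub-histories per region),
the count is absorbed into the tree-decay weight (`count_absorb`), gen 2's injective case is the fibre count `N ≡ 1`
(`fiber_of_injective`), and `uvIneq_of_structure_fiber` is gen 2's `uvIneq_of_structure` with `(hinj, hmaj)` replaced by
the fibre hypothesis.

WHAT IS *NOT* REPRODUCED OR ASSERTED: (1.71)–(1.73), (1.79), (1.89), (1.98)–(1.100), (2.49) themselves — the operations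
are abstract `PosOp`s (their positivity = the quoted p. 380 sentence; that the genuine 𝐓′_k(X,(U,0)) is an integral
against a positive density over a domain cut out by characteristic and δ-functions of real variables is cell GAPS
G-B16-16's reading, not re-derived), the factor bounds are HYPOTHESES with the locators above (the product-over-components
form of the `Z_k`-operation's weight rests on the p. 378 factorization sentence and p. 387's "arbitrary large field
region"; 𝐓″_k is not displayed in [V], p. 356); the gauge-fixing δ-functions `δ_{G_i}(V′_k)` of (1.72)/(1.102) are read,
as in (0.1)/(1.1) themselves (`B16.UVIneq` bounds a density carrying `δ_{G_0}(V′_k)` pointwise), relative to the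
gauge-fixed reference measure, i.e. as multipliers with values in `[0,1]`; the non-negativity of the curly bracket on real
fields ((1.98): `exp` of a real sum — the reality of the activities 𝐑′^{(k)}, 𝐁′^{(k)} under the analytic extension is
printed nowhere, cell GAPS C-B16-8 / G-adv3-2a) is the hypothesis `hcurly`; which density (0.1) bounds (`ρ_k` or `𝐑ρ_k`)
is the run datum `D.ρ k` (gen 2's remark); the cube count `hπ` (cell GAPS C-adv3-6) and the lower bookkeeping `hA'`
(cell GAPS G-adv3-2) are untouched.  Instantiated with trivial data the theorems restate their hypotheses — the content
is that U1 and L1 are NOT independent leaves: they follow from the displayed structure of (1.72), the positivity (1.73)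
and the factor bounds the paper proves or asserts elsewhere.  NOTHING of the series is asserted; value = typed skeleton
+ located leaves + kernel bookkeeping, NOT summit progress.  Unit `b2b-balaban-pv06-g4` (surge node prover #06, gen 4);
companion rows: cell `GAPS.md` C-pv06-4 (this certification), G-pv06-3, G-adv3-1, G-adv3-2a, G-B16-16, C-B16-8,
C-B16-9, C-pv06-2, C-pv06-3; `DIVERGENCE.md` D-pv06.4.
-/

namespace Literature.MathematicalPhysics.QuantumFieldTheory.Balaban1983to89.B16Cor3Ops

open Literature.MathematicalPhysics.QuantumFieldTheory.Balaban1983to89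

/-! ## 1. Positive operations: (1.73) p. 380 and its iteration -/

/-- A POSITIVE OPERATION on real functions of the fields — the typed reading of *"the exponential density in the
integral is positive"* (pp. 379–380 [25–26]) for `𝐓′_k(X,(U,0))`, `𝐓″_k(Z_k)`, `𝐓_k(Y)` of (1.71)/(1.72)/(1.102) at a
real configuration: a map `T` on functions `C → ℝ` (`C` = all field variables; `T F` is again a function of the fields,
constant in the integrated ones) which is MONOTONE (`F ≤ G ⟹ TF ≤ TG`) and HOMOGENEOUS (`T(cF) = c·TF`).  These are the
two properties of an integral against a positive density used in (1.73); additivity is not needed.  Instances: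
`ofKernel` (the finite positive functional of the sibling `B16.ineq173`), `mulOp`, `sumOp`, `comp`, `idOp`. [cite: Balaban1989LargeFieldII, (1.73) p.380] -/
structure PosOp (C : Type*) where
  T : (C → ℝ) → C → ℝ
  mono : ∀ F G : C → ℝ, (∀ x, F x ≤ G x) → ∀ x, T F x ≤ T G x
  smul : ∀ (c : ℝ) (F : C → ℝ) (x : C), T (fun y => c * F y) x = c * T F x

namespace PosOp

variable {C : Type*}

/-- `T 0 = 0` (homogeneity with `c = 0`). [folklore] -/
theorem map_zero (P : PosOp C) (x : C) : P.T 0 x = 0 := by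
  have h := P.smul 0 0 x
  have e : (fun y => (0 : ℝ) * (0 : C → ℝ) y) = 0 := by
    funext y
    simp
  rw [e] at h
  simpa using h

/-- Positivity: `F ≥ 0 ⟹ TF ≥ 0` (monotonicity from `0`). [folklore] -/
theorem apply_nonneg (P : PosOp C) {F : C → ℝ} (hF : ∀ y, 0 ≤ F y) (x : C) : 0 ≤ P.T F x := by
  have h := P.mono 0 F (fun y => by simpa using hF y) x
  rwa [P.map_zero] at h

/-- In particular `T1 ≥ 0` — *"The expression 𝐓′_k(X,(U,0))1 is obviously positive"* (p. 380) in its weak form; the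
STRICT positivity is not typed and not needed (cell GAPS G-B16-16). [cite: Balaban1989LargeFieldII, p.380 after (1.74)] -/
theorem one_nonneg (P : PosOp C) (x : C) : 0 ≤ P.T 1 x :=
  P.apply_nonneg (fun _ => by simp) x

/-- `F ≤ B` everywhere ⟹ `TF ≤ B·T1` (monotonicity + homogeneity). [folklore] -/
theorem apply_le_of_le (P : PosOp C) {F : C → ℝ} {B : ℝ} (hF : ∀ y, F y ≤ B) (x : C) :
    P.T F x ≤ B * P.T 1 x := by
  have h := P.mono F (fun y => B * (1 : C → ℝ) y) (fun y => by simpa using hF y) x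
  rwa [P.smul] at h

/-- `B ≤ F` everywhere ⟹ `B·T1 ≤ TF`. [folklore] -/
theorem le_apply_of_le (P : PosOp C) {F : C → ℝ} {B : ℝ} (hF : ∀ y, B ≤ F y) (x : C) :
    B * P.T 1 x ≤ P.T F x := by
  have h := P.mono (fun y => B * (1 : C → ℝ) y) F (fun y => by simpa using hF y) x
  rwa [P.smul] at h

/-- **(1.73)** p. 380 [26] at the real configuration `(U,0)` (`σ = 0`), verbatim *"|𝐓′_k(X,(𝐔,𝐉))F| = |𝐓′_k(X,(U,0))
e^σF| ≤ 𝐓′_k(X,(U,0))|e^σF| ≤ (𝐓′_k(X,(U,0))1) sup e^{|σ|}|F|"*: for a positive operation and `|F| ≤ B` everywhere,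
`|TF| ≤ B · T1` pointwise (the printed `(𝐓′1)·sup|F|`, with any bound `B ≥ sup|F|`). [cite: Balaban1989LargeFieldII, (1.73) p.380] -/
theorem abs_apply_le (P : PosOp C) {F : C → ℝ} {B : ℝ} (hF : ∀ y, |F y| ≤ B) (x : C) :
    |P.T F x| ≤ B * P.T 1 x := by
  rw [abs_le]
  refine ⟨?_, P.apply_le_of_le (fun y => (abs_le.mp (hF y)).2) x⟩
  have h := P.le_apply_of_le (F := F) (B := -B) (fun y => (abs_le.mp (hF y)).1) x
  linarith

/-- The identity operation (no large-field region: `Z_k = ∅`, `m = 0` — "(Σ𝐓″_k(∅)) = 1", the empty product of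
`𝐓_k(Y_i)`). [folklore] -/
def idOp : PosOp C where
  T F := F
  mono _ _ h x := h x
  smul _ _ _ := rfl

/-- Composition of positive operations (the operations of (1.72) act on everything to their right: `𝐓″_k(Z_k)` on
`exp A′_k Π_i 𝐓_k(Y_i){⋯}`, each `𝐓_k(Y_i)` on the curly bracket). [folklore] -/
def comp (P Q : PosOp C) : PosOp C where
  T F := P.T (Q.T F)
  mono F G h x := P.mono _ _ (fun y => Q.mono F G h y) x
  smul c F x := by
    show P.T (Q.T (fun y => c * F y)) x = c * P.T (Q.T F) x
    have e : Q.T (fun y => c * F y) = fun y => c * Q.T F y := funext fun y => Q.smul c F y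
    rw [e, P.smul]

/-- Multiplication by a non-negative function (the characteristic functions `χ_k(…)`, `χ^c_k(Y^{~−6})χ_{k,Λ}` and — read
relative to the gauge-fixed measure — `δ_G` of (1.72)/(1.102)). [folklore] -/
def mulOp (m : C → ℝ) (hm : ∀ x, 0 ≤ m x) : PosOp C where
  T F x := m x * F x
  mono F G h x := mul_le_mul_of_nonneg_left (h x) (hm x)
  smul c F x := by
    show m x * (c * F x) = c * (m x * F x)
    ring

/-- A finite sum of positive operations — the parenthesised history sum `(Σ_{{Ω^c_j,Z_j}} 𝐓″_k(Z_k))` of (1.72) and the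
sum `Σ_{{Ω^c_j∩X, Z_j∩X}, r}` inside (1.71). [cite: Balaban1989LargeFieldII, (1.72) p.379] -/
def sumOp {H : Type*} (S : Finset H) (ops : H → PosOp C) : PosOp C where
  T F x := ∑ h ∈ S, (ops h).T F x
  mono F G hFG x := Finset.sum_le_sum fun h _ => (ops h).mono F G hFG x
  smul c F x := by
    show ∑ h ∈ S, (ops h).T (fun y => c * F y) x = c * ∑ h ∈ S, (ops h).T F x
    rw [Finset.mul_sum]
    exact Finset.sum_congr rfl fun h _ => (ops h).smul c F x

/-- The model of the sibling `B16.ineq173`: an integral against a positive density, here a finite positive kernel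
`(TF)(x) = Σ_{ω∈S} K(x,ω) F(φ_ω(x))` (`φ_ω(x)` = the configuration with the integration variables set to `ω`, `K ≥ 0`
= *"the exponential density in the integral is positive"*).  It IS a positive operation — the interface is not empty
and carries no hidden assumption. [cite: Balaban1989LargeFieldII, (1.71) p.378 and p.380 l.1] -/
def ofKernel {Ω : Type*} (S : Finset Ω) (K : C → Ω → ℝ) (φ : Ω → C → C) (hK : ∀ x ω, 0 ≤ K x ω) : PosOp C where
  T F x := ∑ ω ∈ S, K x ω * F (φ ω x)
  mono F G h x := Finset.sum_le_sum fun ω _ => mul_le_mul_of_nonneg_left (h _) (hK x ω)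
  smul c F x := by
    show ∑ ω ∈ S, K x ω * (c * F (φ ω x)) = c * ∑ ω ∈ S, K x ω * F (φ ω x)
    rw [Finset.mul_sum]
    exact Finset.sum_congr rfl fun ω _ => by ring

/-- For the kernel model, `T1 = Σ_ω K(·,ω)` (the total mass of the density — the quantity `𝐓′_k(X)1` that (1.79)/(1.89)
bound). [folklore] -/
theorem ofKernel_one {Ω : Type*} (S : Finset Ω) (K : C → Ω → ℝ) (φ : Ω → C → C) (hK : ∀ x ω, 0 ≤ K x ω) (x : C) :
    (ofKernel S K φ hK).T 1 x = ∑ ω ∈ S, K x ω := by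
  show ∑ ω ∈ S, K x ω * (1 : C → ℝ) (φ ω x) = ∑ ω ∈ S, K x ω
  simp

/-- A multiplier with values in `[0,1]` in front of an operation does not increase the weight: `(m·P)1 ≤ P1` (how
`𝐓_k(Y)1 ≤ 𝐓′_k(Y)1` for (1.102), so that (1.89) for `𝐓′_k(Y)` bounds `𝐓_k(Y)1`). [cite: Balaban1989LargeFieldII, (1.102) p.390] -/
theorem mulOp_comp_one_le (m : C → ℝ) (hm : ∀ x, 0 ≤ m x) (hm1 : ∀ x, m x ≤ 1) (P : PosOp C) (x : C) :
    ((mulOp m hm).comp P).T 1 x ≤ P.T 1 x := by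
  show m x * P.T 1 x ≤ P.T 1 x
  have h := mul_le_mul_of_nonneg_right (hm1 x) (P.one_nonneg x)
  rwa [one_mul] at h

/-- The composite `T_{d₁} ∘ ⋯ ∘ T_{d_n}` of a list of operations (`Π_{i=1}^{m} 𝐓_k(Y_i)` of (1.72): operations localized in
disjoint components, p. 379 *"All the expressions in the above integral operation are localized in the domain X"*, in any
enumeration). [cite: Balaban1989LargeFieldII, (1.72) p.379] -/
def pi {δ : Type*} (ops : δ → PosOp C) : List δ → PosOp C
  | [] => idOp
  | d :: l => (ops d).comp (pi ops l)

/-- **(1.73) iterated**: if every factor has a UNIFORM weight `T_d 1 ≤ w_d` (as (1.89) gives: a bound by a constant), the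
composite satisfies `(T_{d₁}∘⋯∘T_{d_n})1 ≤ Π_i w_{d_i}` pointwise — each factor sees the weight of the operations to its
right as a constant bound and contributes its own (`apply_le_of_le`); no commutation or independence of the integration
variables is needed for the UPPER bound. [cite: Balaban1989LargeFieldII, (1.73) p.380] -/
theorem pi_one_le {δ : Type*} (ops : δ → PosOp C) (w : δ → ℝ) (hw : ∀ d x, (ops d).T 1 x ≤ w d) :
    ∀ (l : List δ) (x : C), (pi ops l).T 1 x ≤ (l.map w).prod
  | [], x => by
      show (1 : C → ℝ) x ≤ (([] : List δ).map w).prod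
      simp
  | d :: l, x => by
      have hwnn : ∀ d', 0 ≤ w d' := fun d' => ((ops d').one_nonneg x).trans (hw d' x)
      have hprod : 0 ≤ (l.map w).prod :=
        List.prod_nonneg fun a ha => by
          obtain ⟨d', -, rfl⟩ := List.mem_map.mp ha
          exact hwnn d'
      show (ops d).T ((pi ops l).T 1) x ≤ ((d :: l).map w).prod
      rw [List.map_cons, List.prod_cons]
      calc (ops d).T ((pi ops l).T 1) x ≤ (l.map w).prod * (ops d).T 1 x :=
            (ops d).apply_le_of_le (fun y => pi_one_le ops w hw l y) x
        _ ≤ (l.map w).prod * w d := mul_le_mul_of_nonneg_left (hw d x) hprod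
        _ = w d * (l.map w).prod := mul_comm _ _

/-- The same with the product written over the finite FAMILY `{Y_1,…,Y_m}` (a nodup enumeration `l` of it): `(Π_i
𝐓_k(Y_i))1 ≤ Π_{Y ∈ {Y_i}} w(Y)` — the form of the hypothesis `hY` of `Repr172.abs_term_le` below. [folklore] -/
theorem pi_one_le_prod {δ : Type*} [DecidableEq δ] (ops : δ → PosOp C) (w : δ → ℝ)
    (hw : ∀ d x, (ops d).T 1 x ≤ w d) {l : List δ} (hl : l.Nodup) (x : C) :
    (pi ops l).T 1 x ≤ ∏ d ∈ l.toFinset, w d := by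
  rw [List.prod_toFinset w hl]
  exact pi_one_le ops w hw l x

end PosOp

/-! ## 2. (1.72) as term data: injective indexing, U1 and L1 proved -/

/-- **(1.72)** p. 379 [25] typed as TERM DATA over the configuration space `Cfg` (= `V_k`) and the type `Dom` of
current-scale domains (`𝐃_k`; reading (α) of the sibling `B16Cor3Scales`: every live component is a union of cubes of
the current step).  A summand `a : Adm` of the double sum `Σ_{Z_k} Σ_{{Y_1,…,Y_m}}` is recorded by `Zc a` = the set of
components of the new region `Z_k` and `Ys a` = the family `{Y_1,…,Y_m}` of second-class components (p. 378), and
`index_inj` says the summand is DETERMINED by this pair (a region is the union of its components; every sum over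
histories `{Ω^c_j, Z_j}` is inside the summand — in the parenthesis for `Z_k`, inside `𝐓′_k` by (1.71) for the `Y_i` and
the `X_j` — as displayed; cell GAPS C-B16-9).  The summand is `χ a` (= `χ_k((Ω_k∩⋂(Y_i^c)^{~2})^{~4})`, values in
`[0,1]`) times `TZ a` (= `(Σ_{{Ω^c_j,Z_j}}𝐓″_k(Z_k))`, one positive operation) applied to `exp A'` (= `exp A′_k(1/g_k², U_k)`,
one global function: the completed action of p. 377) times `TYs a` (= `Π_{i=1}^{m} 𝐓_k(Y_i)`, (1.102), one composite
positive operation, `PosOp.pi` of the single ones) applied to `curly a` (= the curly bracket `{Σ_{n≥0}Σ_{{X_j}}Π_j𝐓′_k(X_j)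
exp Σ_Y V(Y,U_k)}` = `exp Σ_X 𝐑′^{(k)}(X)` by (1.98), REAL-valued here: real fields).  `allSmall` = the summand with
`Z_k = ∅`, `m = 0` (p. 391's "term without large field regions"): no components, both operations the identity. [cite: Balaban1989LargeFieldII, (1.72) p.379] -/
structure Repr172 (Cfg : Type*) (Dom : Type*) where
  Adm : Type
  [finAdm : Fintype Adm]
  Zc : Adm → Finset Dom
  Ys : Adm → Finset Dom
  index_inj : ∀ a b, Zc a = Zc b → Ys a = Ys b → a = b
  χ : Adm → Cfg → ℝ
  TZ : Adm → PosOp Cfg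
  TYs : Adm → PosOp Cfg
  A' : Cfg → ℝ
  curly : Adm → Cfg → ℝ
  allSmall : Adm
  Zc_allSmall : Zc allSmall = ∅
  Ys_allSmall : Ys allSmall = ∅
  TZ_allSmall : ∀ F, (TZ allSmall).T F = F
  TYs_allSmall : ∀ F, (TYs allSmall).T F = F

namespace Repr172

variable {Cfg : Type*} {Dom : Type*}

/-- The index set of (1.72) is finite (finitely many regions on the finite lattice `T^{(k)}_1`); exposes `finAdm`. [cite: Balaban1989LargeFieldII, (1.72) p.379] -/
instance instFintypeAdm (R : Repr172 Cfg Dom) : Fintype R.Adm := R.finAdm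

/-- The function the `Z_k`-operation acts on: `exp A′_k · (Π_i 𝐓_k(Y_i)){⋯}` (p. 379: the operations act on everything
to their right; "the sum in the definition (1.71) acts also on the last exponential in (1.72)"). [cite: Balaban1989LargeFieldII, (1.72) p.379] -/
noncomputable def inner (R : Repr172 Cfg Dom) (a : R.Adm) : Cfg → ℝ :=
  fun V => Real.exp (R.A' V) * (R.TYs a).T (R.curly a) V

/-- The summand of (1.72) indexed by `a = (Z_k, {Y_i})` as a function of `V_k`:
`χ_a · (Σ𝐓″_k(Z_k))[exp A′_k · Π_i𝐓_k(Y_i){⋯}]`. [cite: Balaban1989LargeFieldII, (1.72) p.379] -/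
noncomputable def term (R : Repr172 Cfg Dom) (a : R.Adm) (V : Cfg) : ℝ :=
  R.χ a V * (R.TZ a).T (R.inner a) V

/-- (1.72) HOLDS for the density `Rρ` (= `𝐑ρ_k` as a function of `V_k`): `𝐑ρ_k(V) = Σ_a term_a(V)`. [cite: Balaban1989LargeFieldII, (1.72) p.379] -/
def Holds (R : Repr172 Cfg Dom) (Rρ : Cfg → ℝ) : Prop :=
  ∀ V, Rρ V = ∑ a, R.term a V

/-- The all-small summand: `χ · exp A′_k · {⋯}` (both operations the identity). [folklore] -/
theorem term_allSmall (R : Repr172 Cfg Dom) (V : Cfg) :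
    R.term R.allSmall V = R.χ R.allSmall V * (Real.exp (R.A' V) * R.curly R.allSmall V) := by
  show R.χ R.allSmall V * (R.TZ R.allSmall).T (R.inner R.allSmall) V = _
  rw [R.TZ_allSmall]
  simp only [inner, R.TYs_allSmall]

/-- **Leaf U1, per term** — the majorisation of a summand of (1.72) by (1.73) applied twice over the four factor
bounds: `0 ≤ χ_a ≤ 1` (characteristic function); `TZ_a 1 ≤ wZ` [(1.79)/(1.89)-improved for the new region `Z_k`: p. 387
*"the inequality (1.79) holds for the 𝐓-operation connected with an arbitrary large field region … hence also an
improved bound (1.89)"*, multiplied over its components by p. 378 *"these integrations factorize in components of Z"*,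
the history sum included by the p. 383 sentence]; `TYs_a 1 ≤ wY` [(1.89)-improved per `Y_i`, composed: `PosOp.pi_one_le`];
`A′_k ≤ BA` [the upper (2.49) [III] bookkeeping, `BA = E′|T|`]; `|curly_a| ≤ Bc` [(1.98) with (1.99)/(1.100) summed,
`Bc = e^{ε′|T|}`].  Conclusion `|term_a| ≤ e^{BA}·Bc·(wZ·wY)` pointwise.  Kernel bookkeeping; the factor bounds are
hypotheses. [cite: Balaban1989LargeFieldII, (1.73) p.380 and p.387 after (1.89)] -/
theorem abs_term_le (R : Repr172 Cfg Dom) (a : R.Adm) {wZ wY BA Bc : ℝ}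
    (hχ : ∀ V, 0 ≤ R.χ a V ∧ R.χ a V ≤ 1)
    (hZ : ∀ V, (R.TZ a).T 1 V ≤ wZ) (hY : ∀ V, (R.TYs a).T 1 V ≤ wY)
    (hA : ∀ V, R.A' V ≤ BA) (hc : ∀ V, |R.curly a V| ≤ Bc) (V : Cfg) :
    |R.term a V| ≤ Real.exp BA * Bc * (wZ * wY) := by
  have hBc : 0 ≤ Bc := (abs_nonneg _).trans (hc V)
  have hwY : 0 ≤ wY := ((R.TYs a).one_nonneg V).trans (hY V)
  have h1 : ∀ V', |(R.TYs a).T (R.curly a) V'| ≤ Bc * wY := fun V' =>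
    ((R.TYs a).abs_apply_le hc V').trans (mul_le_mul_of_nonneg_left (hY V') hBc)
  have h2 : ∀ V', |R.inner a V'| ≤ Real.exp BA * (Bc * wY) := fun V' => by
    unfold inner
    rw [abs_mul, abs_of_pos (Real.exp_pos _)]
    exact mul_le_mul (Real.exp_le_exp.mpr (hA V')) (h1 V') (abs_nonneg _) (Real.exp_pos _).le
  have hK : 0 ≤ Real.exp BA * (Bc * wY) := mul_nonneg (Real.exp_pos _).le (mul_nonneg hBc hwY)
  have h3 : |(R.TZ a).T (R.inner a) V| ≤ Real.exp BA * (Bc * wY) * wZ :=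
    ((R.TZ a).abs_apply_le h2 V).trans (mul_le_mul_of_nonneg_left (hZ V) hK)
  show |R.χ a V * (R.TZ a).T (R.inner a) V| ≤ _
  rw [abs_mul, abs_of_nonneg (hχ V).1]
  calc R.χ a V * |(R.TZ a).T (R.inner a) V| ≤ 1 * (Real.exp BA * (Bc * wY) * wZ) :=
        mul_le_mul (hχ V).2 h3 (abs_nonneg _) zero_le_one
    _ = Real.exp BA * Bc * (wZ * wY) := by ring

/-- **Leaf L1, per term** — every summand of (1.72) is `≥ 0` on real fields: the operations are positive
(`PosOp.apply_nonneg`, p. 380), `χ_a ≥ 0`, `exp A′_k > 0`, and the curly bracket is `≥ 0` (= `exp Σ_X𝐑′^{(k)}(X)` by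
(1.98); its reality on real fields is the hypothesis — cell GAPS G-adv3-2a "L1-real", C-B16-8). [cite: Balaban1989LargeFieldII, p.380 l.1 and (1.98) p.390] -/
theorem term_nonneg (R : Repr172 Cfg Dom) (a : R.Adm) (hχ : ∀ V, 0 ≤ R.χ a V)
    (hc : ∀ V, 0 ≤ R.curly a V) (V : Cfg) : 0 ≤ R.term a V := by
  have h1 : ∀ V', 0 ≤ R.inner a V' := fun V' =>
    mul_nonneg (Real.exp_pos _).le ((R.TYs a).apply_nonneg hc V')
  exact mul_nonneg (hχ V) ((R.TZ a).apply_nonneg h1 V)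

/-! ### The family map into `Fin 2 × 𝐃_k` and its injectivity (the `hinj` of `B16Cor3` / `B16Cor3Scales`) -/

/-- The two classes of tokens of a summand as a tagged embedding `𝐃_k ⊎ 𝐃_k ↪ Fin 2 × 𝐃_k`: class `0` = a component of
the new region `Z_k`, class `1` = one of the `Y_i` (p. 390: *"The new large field region is equal to Z_k ∪ ⋃_i Y_i"*).
[cite: Balaban1989LargeFieldII, p.390 before (1.102)] -/
def tagEmb (Dom : Type*) : Dom ⊕ Dom ↪ Fin 2 × Dom :=
  ⟨Sum.elim (fun X => ((0 : Fin 2), X)) (fun Y => ((1 : Fin 2), Y)), by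
    rintro (X | X) (Y | Y) h
    · simp only [Sum.elim_inl, Prod.mk.injEq] at h
      rw [h.2]
    · simp only [Sum.elim_inl, Sum.elim_inr, Prod.mk.injEq] at h
      exact absurd h.1 (by decide)
    · simp only [Sum.elim_inl, Sum.elim_inr, Prod.mk.injEq] at h
      exact absurd h.1 (by decide)
    · simp only [Sum.elim_inr, Prod.mk.injEq] at h
      rw [h.2]⟩

/-- The family of tokens of the summand `a`: (components of `Z_k`) ⊎ `{Y_1,…,Y_m}` as a finite subset of `Fin 2 × 𝐃_k`
— the `fam a` of `B16Cor3Scales.uvIneq_of_structure_classes` with `m = 2` classes. [cite: Balaban1989LargeFieldII, (1.72) p.379] -/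
def fam (R : Repr172 Cfg Dom) (a : R.Adm) : Finset (Fin 2 × Dom) :=
  ((R.Zc a).disjSum (R.Ys a)).map (tagEmb Dom)

/-- `disjSum` is injective in both arguments (membership of `inl`/`inr`). [folklore] -/
theorem disjSum_inj {s s' t t' : Finset Dom} (h : s.disjSum t = s'.disjSum t') : s = s' ∧ t = t' := by
  constructor
  · ext X
    have h1 := congrArg (fun u => (Sum.inl X : Dom ⊕ Dom) ∈ u) h
    simpa using h1
  · ext Y
    have h1 := congrArg (fun u => (Sum.inr Y : Dom ⊕ Dom) ∈ u) h
    simpa using h1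

/-- **`hinj` PROVED for (1.72)**: the family map is injective — distinct summands `(Z_k, {Y_i})` have distinct tagged
families (a region is determined by its components: `index_inj`).  This is the injective indexing that gen 2's entropy
lemma `B16Cor3.sum_major_le_exp` takes as hypothesis, under reading (α). [cite: Balaban1989LargeFieldII, (1.72) p.379] -/
theorem fam_injective (R : Repr172 Cfg Dom) : Function.Injective R.fam := by
  intro a b h
  have h1 : (R.Zc a).disjSum (R.Ys a) = (R.Zc b).disjSum (R.Ys b) := Finset.map_injective (tagEmb Dom) h
  obtain ⟨hZ, hY⟩ := disjSum_inj h1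
  exact R.index_inj a b hZ hY

/-- The product of weights over the tagged family splits into the two classes. [folklore] -/
theorem prod_fam (R : Repr172 Cfg Dom) (W : Fin 2 × Dom → ℝ) (a : R.Adm) :
    ∏ t ∈ R.fam a, W t = (∏ X ∈ R.Zc a, W (0, X)) * ∏ Y ∈ R.Ys a, W (1, Y) := by
  unfold fam
  rw [Finset.prod_map, Finset.prod_disjSum]
  rfl

/-- **Discharging `hY` from the single-component bounds**: if `TYs a` is the composite `PosOp.pi TY (l a)` of the
single operations `𝐓_k(Y)` ((1.102)) over a nodup enumeration `l a` of `{Y_1,…,Y_m}` and every `𝐓_k(Y)1 ≤ w(Y)` uniformly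
in the configuration ((1.89) improved, p. 387; the `[0,1]`-valued multipliers of (1.102) removed by
`PosOp.mulOp_comp_one_le`), then `TYs_a 1 ≤ Π_{Y ∈ Ys a} w(Y)` — (1.73) iterated, `PosOp.pi_one_le_prod`. [cite: Balaban1989LargeFieldII, (1.89) p.387 and (1.102) p.390] -/
theorem tys_one_le_of_factors [DecidableEq Dom] (R : Repr172 Cfg Dom) (TY : Dom → PosOp Cfg) (w : Dom → ℝ)
    (hw : ∀ Y V, (TY Y).T 1 V ≤ w Y) (l : R.Adm → List Dom) (hnd : ∀ a, (l a).Nodup)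
    (hset : ∀ a, (l a).toFinset = R.Ys a) (hT : ∀ a, R.TYs a = PosOp.pi TY (l a)) :
    ∀ a V, (R.TYs a).T 1 V ≤ ∏ Y ∈ R.Ys a, w Y := by
  intro a V
  rw [hT a, ← hset a]
  exact PosOp.pi_one_le_prod TY w hw (hnd a) V

/-- (1.72) read as (2.18)-data for `B14Cor3` (as gen 2's `Repr1104.toTermData`): summands `term`, majorants `major`,
all-small index. [folklore] -/
noncomputable def toTermData {D : B16.RunData} {k : ℕ} (R : Repr172 (D.Cfg k) Dom) (major : R.Adm → ℝ) :
    B14Cor3.TermData D k where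
  Adm := R.Adm
  term := R.term
  major := major
  allSmall := R.allSmall

/-- If (1.72) holds for `D.ρ k` then the associated (2.18)-data holds. [folklore] -/
theorem termData_holds {D : B16.RunData} {k : ℕ} (R : Repr172 (D.Cfg k) Dom) (major : R.Adm → ℝ)
    (h : R.Holds (D.ρ k)) : (R.toTermData major).Holds :=
  h

/-- **The all-small form `hform` PROVED**: if the characteristic function of the `Z_k = ∅, m = 0` summand is `χ_k` of
(2.17)/(2.50) [III] (`D.χ k`) and its curly bracket is `exp Σ_X𝐑′^{(k)}(X)` with real sum `Rre` ((1.98)), the summand is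
`χ_k · exp[A′_k + Σ𝐑′]` — the shape consumed by `B16Cor3.allSmall_lower`. [cite: Balaban1989LargeFieldII, (1.98) p.390] -/
theorem form_allSmall {D : B16.RunData} {k : ℕ} (R : Repr172 (D.Cfg k) Dom) (Rre : D.Cfg k → ℝ)
    (h0χ : ∀ V, R.χ R.allSmall V = D.χ k V) (h0c : ∀ V, R.curly R.allSmall V = Real.exp (Rre V)) :
    ∀ V, R.term R.allSmall V = D.χ k V * Real.exp (R.A' V + Rre V) := by
  intro V
  rw [term_allSmall, h0χ, h0c, Real.exp_add]

/-- **(2.50)/(0.1), one run, one step, from (1.72) + (1.73)** — `B16Cor3Scales.uvIneq_of_structure_classes` (reading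
(α), `m = 2` classes: components of `Z_k` with small factor `e^{−c 0}`, the `Y_i` with `e^{−c 1}`; tree decay
`e^{−κ₁d_k}`, `κ₁ ≥ κ₀(c₀,Δ)`, cube count `|π_k| ≤ πc·N`) with its per-term hypotheses DISCHARGED: `hinj` = `fam_injective`,
`hU1`/`hmaj` = `abs_term_le`, `hL1` = `term_nonneg`, `hform` = `form_allSmall`.  Remaining hypotheses: (1.72) holds for
the density (`hH`); characteristic functions in `[0,1]` (`hχ01`) and the all-small one `= χ_k` (`h0χ`); the factor leaves
`hZ` [(1.79)/(1.89)-improved for the new region, product over its components], `hY` [(1.89)-improved per `Y_i`,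
composed], `hA'up` [upper (2.49) [III] bookkeeping `A′_k ≤ E′N`], `hcurly` [`0 ≤ {⋯} ≤ e^{ε′N}`: (1.98) + (1.99)/(1.100)
summed, reality on real fields], `h0c` + `hR` [`{⋯}_{allSmall} = exp Σ𝐑′`, `|Σ𝐑′| ≤ εN`: (1.100) summed,
`B16Cor3.abs_re_sumR_le`]; the lower (2.49) bookkeeping `hA'`; the cube count `hπ`.  Conclusion: `B16.UVIneq` at every
configuration with `E₋ = E₁ + ε`, `E₊ = E′ + ε′ + πc·K₀(c₀,Δ)·Σ_{i<2} e^{−c i}`. [cite: Balaban1989LargeFieldII, (0.1) p.356 and p.387 after (1.89)] -/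
theorem uvIneq_of_repr172 (D : B16.RunData) (k : ℕ) (S : LocDomainSys) (R : Repr172 (D.Cfg k) S.Dom)
    (G : B12TreeDecay.CubeSystem S) {Δ : ℕ} (hΔ : G.DegreeLE Δ) {c₀ : ℝ}
    (hV : G.VolumeLeaf c₀) {κ₁ : ℝ} (hκ : B12TreeDecay.kappa₀ c₀ Δ ≤ κ₁)
    (c : Fin 2 → ℝ) (πc : ℝ) (hπ : (Fintype.card G.toCubeCover.Cube : ℝ) ≤ πc * (D.numSites k : ℝ))
    (Rre : D.Cfg k → ℝ) (E₁ ε ε' E' : ℝ)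
    (hH : R.Holds (D.ρ k))
    (hχ01 : ∀ a V, 0 ≤ R.χ a V ∧ R.χ a V ≤ 1)
    (h0χ : ∀ V, R.χ R.allSmall V = D.χ k V)
    (hZ : ∀ a V, (R.TZ a).T 1 V ≤ ∏ X ∈ R.Zc a, Real.exp (-(c 0) - κ₁ * S.dj X))
    (hY : ∀ a V, (R.TYs a).T 1 V ≤ ∏ Y ∈ R.Ys a, Real.exp (-(c 1) - κ₁ * S.dj Y))
    (hA'up : ∀ V, R.A' V ≤ E' * (D.numSites k : ℝ))
    (hcurly : ∀ a V, 0 ≤ R.curly a V ∧ R.curly a V ≤ Real.exp (ε' * (D.numSites k : ℝ)))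
    (h0c : ∀ V, R.curly R.allSmall V = Real.exp (Rre V))
    (hR : ∀ V, |Rre V| ≤ ε * (D.numSites k : ℝ))
    (hA' : ∀ V, D.χ k V ≠ 0 →
      -(1 / (D.flow.g k) ^ 2 * D.wilsonBG k V) - E₁ * (D.numSites k : ℝ) ≤ R.A' V) :
    ∀ V : D.Cfg k, B16.UVIneq D k V (E₁ + ε)
      (E' + ε' + πc * B12TreeDecay.K₀ c₀ Δ * ∑ i, Real.exp (-(c i))) := by
  set N : ℝ := (D.numSites k : ℝ) with hN
  let W : Fin 2 × S.Dom → ℝ := fun t => Real.exp (-(c t.1) - κ₁ * S.dj t.2)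
  let major : R.Adm → ℝ := fun a => Real.exp ((E' + ε') * N) * ∏ t ∈ R.fam a, W t
  have habs : ∀ a V, |R.curly a V| ≤ Real.exp (ε' * N) := fun a V => by
    rw [abs_of_nonneg (hcurly a V).1]
    exact (hcurly a V).2
  have hU1 : ∀ a V, R.term a V ≤ major a := fun a V => by
    have h := R.abs_term_le a (hχ01 a) (hZ a) (hY a) hA'up (habs a) V
    refine (le_abs_self _).trans (h.trans (le_of_eq ?_))
    show _ = Real.exp ((E' + ε') * N) * ∏ t ∈ R.fam a, W t
    rw [R.prod_fam W a, ← Real.exp_add, show E' * N + ε' * N = (E' + ε') * N by ring]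
  have hL1 : ∀ a V, 0 ≤ R.term a V := fun a V => R.term_nonneg a (fun V => (hχ01 a V).1) (fun V => (hcurly a V).1) V
  have hχ : ∀ V, 0 ≤ D.χ k V := fun V => by
    rw [← h0χ V]
    exact (hχ01 R.allSmall V).1
  exact B16Cor3Scales.uvIneq_of_structure_classes D k (R.toTermData major) S G hΔ hV hκ c πc hπ R.fam R.A' Rre
    E₁ ε (E' + ε') (R.termData_holds major hH) hU1 R.fam_injective (fun a => le_rfl) hL1
    (R.form_allSmall Rre h0χ h0c) hχ hA' hR

end Repr172

/-! ## 3. Reading (β): the entropy lemma without injectivity (fibrewise), and the history count as a fibre bound -/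

/-- **Leaf U2 fibrewise** — gen 2's `B16Cor3.sum_major_le_exp` WITHOUT the injectivity of the family map: if for every
family `W` of regions the majorants of the summands carrying exactly that family sum to `≤ B₀·Π_{Y∈W} w(Y)`, then
`Σ_a major_a ≤ B₀·exp(Σ_Y w(Y)) ≤ B₀e^{E}`.  Needed under reading (β) ((2.18) [III]: *"the summation is over admissible
sequences of domains"* — two histories `{Ω_j},{Λ_j}` may carry the same family of large-field regions, so the indexing by
families is NOT injective; the per-family sum is what the p. 383 sentence *"the summations over the admissible sequences
can be replaced by the factors exp O(1)(MR_j)^{−d}|Z_j|"* bounds).  `Finset.sum_fiberwise` + `Π(1 + w) ≤ e^{Σw}`. [cite: Balaban1989LargeFieldII, p.383 before (1.79)] -/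
theorem sum_major_le_exp_fiber {A ι : Type*} [Fintype A] [Fintype ι] [DecidableEq ι] (major : A → ℝ)
    (fam : A → Finset ι) (w : ι → ℝ) (hw : ∀ Y, 0 ≤ w Y) (B₀ E : ℝ) (hB₀ : 0 ≤ B₀)
    (hfib : ∀ W : Finset ι, ∑ a ∈ Finset.univ.filter (fun a => fam a = W), major a ≤ B₀ * ∏ Y ∈ W, w Y)
    (hE : ∑ Y, w Y ≤ E) :
    ∑ a, major a ≤ B₀ * Real.exp E := by
  have hall : ∑ W ∈ (Finset.univ : Finset ι).powerset, ∏ Y ∈ W, w Y ≤ Real.exp E :=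
    (B16Cor3.sum_powerset_prod_le_exp _ _ fun Y _ => hw Y).trans (Real.exp_le_exp.mpr hE)
  calc ∑ a, major a = ∑ W : Finset ι, ∑ a ∈ Finset.univ.filter (fun a => fam a = W), major a :=
        (Finset.sum_fiberwise Finset.univ fam major).symm
    _ ≤ ∑ W : Finset ι, B₀ * ∏ Y ∈ W, w Y := Finset.sum_le_sum fun W _ => hfib W
    _ = B₀ * ∑ W ∈ (Finset.univ : Finset ι).powerset, ∏ Y ∈ W, w Y := by
        rw [← Finset.mul_sum, Finset.powerset_univ]
    _ ≤ B₀ * Real.exp E := mul_le_mul_of_nonneg_left hall hB₀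

/-- **The fibre bound from a per-summand majorant and a FIBRE COUNT**: if every summand satisfies `major_a ≤ B·Π_{Y∈fam a}
w′(Y)` (the printed small factors (1.79)/(1.89) per region, uniform over the history) and the number of summands carrying
the family `W` is `≤ Π_{Y∈W} N(Y)` (histories of disjoint regions are independent; per region at most `N(Y) = exp O(1)
(MR_j)^{−d}|Y|` admissible sub-histories — the p. 383 sentence), then the fibre sums are `≤ B·Π_{Y∈W}(N(Y)w′(Y))`: the
count is a factor of the weight. [cite: Balaban1989LargeFieldII, p.383 before (1.79)] -/
theorem fiber_le_of_card {A ι : Type*} [Fintype A] [DecidableEq ι] (major : A → ℝ) (fam : A → Finset ι)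
    (w' Ncount : ι → ℝ) (B : ℝ) (hB : 0 ≤ B) (hw' : ∀ Y, 0 ≤ w' Y)
    (hpt : ∀ a, major a ≤ B * ∏ Y ∈ fam a, w' Y)
    (hcard : ∀ W : Finset ι, ((Finset.univ.filter (fun a => fam a = W)).card : ℝ) ≤ ∏ Y ∈ W, Ncount Y) :
    ∀ W : Finset ι, ∑ a ∈ Finset.univ.filter (fun a => fam a = W), major a ≤ B * ∏ Y ∈ W, (Ncount Y * w' Y) := by
  intro W
  have hmem : ∀ a ∈ Finset.univ.filter (fun a => fam a = W), major a ≤ B * ∏ Y ∈ W, w' Y := by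
    intro a ha
    have hfa : fam a = W := (Finset.mem_filter.mp ha).2
    rw [← hfa]
    exact hpt a
  have hP : 0 ≤ B * ∏ Y ∈ W, w' Y := mul_nonneg hB (Finset.prod_nonneg fun Y _ => hw' Y)
  calc ∑ a ∈ Finset.univ.filter (fun a => fam a = W), major a
      ≤ (Finset.univ.filter (fun a => fam a = W)).card • (B * ∏ Y ∈ W, w' Y) := Finset.sum_le_card_nsmul _ _ _ hmem
    _ = ((Finset.univ.filter (fun a => fam a = W)).card : ℝ) * (B * ∏ Y ∈ W, w' Y) := nsmul_eq_mul _ _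
    _ ≤ (∏ Y ∈ W, Ncount Y) * (B * ∏ Y ∈ W, w' Y) := mul_le_mul_of_nonneg_right (hcard W) hP
    _ = B * ∏ Y ∈ W, (Ncount Y * w' Y) := by rw [Finset.prod_mul_distrib]; ring

/-- Gen 2's injective case is the fibre count `N ≡ 1`: an injective family map has fibres of cardinality `≤ 1`. [folklore] -/
theorem fiber_of_injective {A ι : Type*} [Fintype A] [DecidableEq ι] (major : A → ℝ) (fam : A → Finset ι)
    (hinj : Function.Injective fam) (w : ι → ℝ) (B : ℝ) (hB : 0 ≤ B) (hw : ∀ Y, 0 ≤ w Y)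
    (hmaj : ∀ a, major a ≤ B * ∏ Y ∈ fam a, w Y) :
    ∀ W : Finset ι, ∑ a ∈ Finset.univ.filter (fun a => fam a = W), major a ≤ B * ∏ Y ∈ W, w Y := by
  intro W
  have h := fiber_le_of_card major fam w (fun _ => 1) B hB hw hmaj (fun W' => ?_) W
  · simpa using h
  · rw [Finset.prod_const_one, Nat.cast_le_one]
    exact Finset.card_le_one.mpr fun a ha b hb =>
      hinj ((Finset.mem_filter.mp ha).2.trans (Finset.mem_filter.mp hb).2.symm)

/-- **Absorbing the history count into the tree-decay weight**: a count of the volume-leaf shape `log N(Y) ≤ h₀ +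
h₁·d(Y)` (`|Y| ≤ c₀(1 + d(Y))` cubes, `B12TreeDecay.VolumeLeaf`, times `O(1)(MR_j)^{−d}` per cube) against a small factor
`exp(−c − κd(Y))` leaves a weight of the same shape with `c − h₀`, `κ − h₁` — so the entropy theorems of gen 2/3
(`lfWeightSum_le`, `classWeightSum_le`, `tokenSum_le`) apply to the counted weight `N·w′` unchanged. [cite: Balaban1989LargeFieldII, p.383 before (1.79)] -/
theorem count_absorb (h₀ h₁ c κ d lN : ℝ) (hN : lN ≤ h₀ + h₁ * d) :
    Real.exp lN * Real.exp (-c - κ * d) ≤ Real.exp (-(c - h₀) - (κ - h₁) * d) := by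
  rw [← Real.exp_add]
  exact Real.exp_le_exp.mpr (by linarith)

/-- **(2.50)/(0.1), one run, one step, reading (β)** — gen 2's `B16Cor3.uvIneq_of_structure` with the injective indexing
and the per-summand majorisation `(hinj, hmaj)` replaced by the FIBRE hypothesis `hfib` (`sum_major_le_exp_fiber`): the
family map `fam` into any finite region type `ι` (e.g. gen 3's birth-scale tokens `B16Cor3Scales.Tok`) need not be
injective.  All other hypotheses and the conclusion (`E₋ = E₁ + ε`, `E₊ = E′ + Ep′`) as there. [cite: Balaban1989LargeFieldII, (0.1) p.356] -/
theorem uvIneq_of_structure_fiber (D : B16.RunData) (k : ℕ) (R : B14Cor3.TermData D k)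
    {ι : Type} [Fintype ι] [DecidableEq ι] (fam : R.Adm → Finset ι) (w : ι → ℝ)
    (A' Rre : D.Cfg k → ℝ) (E₁ ε E' Ep' : ℝ)
    (hH : R.Holds)
    (hU1 : ∀ a V, R.term a V ≤ R.major a)
    (hw : ∀ Y, 0 ≤ w Y)
    (hfib : ∀ W : Finset ι, ∑ a ∈ Finset.univ.filter (fun a => fam a = W), R.major a
      ≤ Real.exp (E' * (D.numSites k : ℝ)) * ∏ Y ∈ W, w Y)
    (hE : ∑ Y, w Y ≤ Ep' * (D.numSites k : ℝ))
    (hL1 : ∀ a V, 0 ≤ R.term a V)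
    (hform : ∀ V, R.term R.allSmall V = D.χ k V * Real.exp (A' V + Rre V))
    (hχ : ∀ V, 0 ≤ D.χ k V)
    (hA' : ∀ V, D.χ k V ≠ 0 →
      -(1 / (D.flow.g k) ^ 2 * D.wilsonBG k V) - E₁ * (D.numSites k : ℝ) ≤ A' V)
    (hR : ∀ V, |Rre V| ≤ ε * (D.numSites k : ℝ)) :
    ∀ V : D.Cfg k, B16.UVIneq D k V (E₁ + ε) (E' + Ep') := by
  refine B14Cor3.uvIneq_of_termData D k R (E₁ + ε) (E' + Ep') hH hU1 ?_ hL1 ?_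
  · have h := sum_major_le_exp_fiber R.major fam w hw _ _ (Real.exp_pos _).le hfib hE
    rw [← Real.exp_add] at h
    convert h using 2
    ring
  · exact B16Cor3.allSmall_lower (D.χ k) (R.term R.allSmall) A' Rre (D.wilsonBG k) (D.flow.g k) E₁ ε
      (D.numSites k : ℝ) hform hχ hA' hR

end Literature.MathematicalPhysics.QuantumFieldTheory.Balaban1983to89.B16Cor3Ops
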